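import Summits.RiemannHypothesis.RiemannHypothesis.Theorems.PfPersistenceEdgeLawCuspDefect

/-!
# Edge law — the cusp modulus with an interior remainder (RH-free)

Part of the pub-rhpf THEORY-2 programme (mechanism / rigidity of the Weil window bottom; no RH
claims). Gen 6 proved (R3) `D_a(t_η) = o(η)` under `HasCuspModulus a u C` (`ũ` is `C`-Lipschitz
in the cusp coordinate `Γ_a`). That hypothesis is too strong for actual window ground states:
the Euler–Lagrange equation contains the truncated prime shifts `ũ(· ± log q)` (`log q < 2a`),
which transport the edge cusp to the interior points `±(a − log q)`, where `ũ` has ONE-SIDED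
logarithmic cusps of order `Λ^{-3/2}` and is not locally Lipschitz (THEORY-2g, DATA E2g7). The
corrected hypothesis `HasCuspModulusWith a u C Ξ` asks
`‖ũ(y) − ũ(x)‖ ≤ C (Γ_a(y) − Γ_a(x)) + (Ξ(y) − Ξ(x))` (`−a ≤ x ≤ y ≤ a`) with a monotone
remainder `Ξ` whose monotone modulus `ω` (`Ξ(x+s) − Ξ(x) ≤ ω(s)`) is Dini-logarithmic,
`ω(s) log(1/s) → 0` (`IsCuspRemainder Ξ ω`): interior cusps of any order `Λ^{-1/2-ε}`, in any
finite number and position, are admissible, and `HasCuspModulus` is the case `Ξ = 0`. Results: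
`HasCuspModulusWith.norm_le` (`‖ũ(y)‖ ≤ C G(a − |y|) + ω(a − |y|)`), `norm_dilationGerm_le_with`
(germ bound), `norm_dilationGerm_sub_le_with` (the germ is `1`-Lipschitz in
`Θ'_η = C Θ_η + (3/2) Ξ((1+η)·) + Ξ`, modulus `≤ 5CG(2h) + (5/2)ω(2h)` at the layer scale, width
`≤ 5CG(a) + (5/2)ω(2a)`), `weilIncrement_weilInteriorDefect_le_with`
(`D_s(t_η) ≤ s · cuspNearRate a C ω η` for `0 < s ≤ h(η)`, `cuspNearRate → 0`). Mass bound and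
(R3): `PfPersistenceEdgeLawCuspInteriorMass`, `PfPersistenceEdgeLawCuspInteriorDefect`.

Sources: E. Bombieri, *Remarks on Weil's quadratic functional in the theory of prime numbers I*,
Rend. Mat. Acc. Lincei (9) 11 (2000) §4 (proof of Thm 5: the dilation). The interior-cusp
mechanism and the remainder form of the hypothesis are this programme's (no literature claim).
-/

set_option linter.dupNamespace false

noncomputable section

open MeasureTheory Set Filter
open scoped Topology ENNReal

namespace Summit.RiemannHypothesis.RiemannHypothesis.Theorems.PfPersistence

open Literature.NumberTheory.LFunctions

variable {a : ℝ} {u : ℝ → ℂ}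

/-! ## Monotone remainders with a Dini–logarithmic modulus -/

/-- A **cusp remainder**: `Ξ` is monotone with increments `Ξ(x+s) − Ξ(x) ≤ ω(s)` (`s ≥ 0`) for a
monotone modulus `ω` with `ω(s) log(1/s) → 0` as `s → 0⁺` (the values of `ω` at `s < 0` are
irrelevant; precompose with `max · 0` if needed). [folklore] -/
structure IsCuspRemainder (Ξ ω : ℝ → ℝ) : Prop where
  mono : Monotone Ξ
  sub_le : ∀ x s, 0 ≤ s → Ξ (x + s) - Ξ x ≤ ω s
  modulus_mono : Monotone ω
  dini : Tendsto (fun s ↦ ω s * Real.log (1 / s)) (𝓝[>] 0) (𝓝 0)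

namespace IsCuspRemainder

variable {Ξ ω : ℝ → ℝ}

/-- The zero remainder. [folklore] -/
theorem zero : IsCuspRemainder (fun _ ↦ 0) (fun _ ↦ 0) where
  mono := monotone_const
  sub_le := fun _ _ _ ↦ by simp
  modulus_mono := monotone_const
  dini := by simp

/-- `Ξ(y) − Ξ(x) ≥ 0` for `x ≤ y`. [folklore] -/
theorem sub_nonneg (h : IsCuspRemainder Ξ ω) {x y : ℝ} (hxy : x ≤ y) : 0 ≤ Ξ y - Ξ x :=
  _root_.sub_nonneg.2 (h.mono hxy)

/-- `Ξ(y) − Ξ(x) ≤ ω(s)` whenever `x ≤ y ≤ x + s`. [folklore] -/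
theorem sub_le_of_le (h : IsCuspRemainder Ξ ω) {x y s : ℝ} (hxy : x ≤ y) (hys : y ≤ x + s) :
    Ξ y - Ξ x ≤ ω s := by
  have h1 := h.sub_le x s (by linarith)
  have h2 := h.mono hys
  linarith

/-- `ω(s) ≥ 0` for `s ≥ 0`. [folklore] -/
theorem modulus_nonneg (h : IsCuspRemainder Ξ ω) {s : ℝ} (hs : 0 ≤ s) : 0 ≤ ω s :=
  (h.sub_nonneg (show (0 : ℝ) ≤ 0 + s by linarith)).trans (h.sub_le 0 s hs)

/-- `ω(s) → 0` as `s → 0⁺` (`log(1/s) ≥ 1` for `s ≤ e⁻¹`). [folklore] -/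
theorem tendsto_modulus (h : IsCuspRemainder Ξ ω) : Tendsto ω (𝓝[>] 0) (𝓝 0) := by
  refine tendsto_of_tendsto_of_tendsto_of_le_of_le' tendsto_const_nhds h.dini ?_ ?_
  · filter_upwards [self_mem_nhdsWithin] with s hs using h.modulus_nonneg (le_of_lt hs)
  · filter_upwards [Ioc_mem_nhdsGT (Real.exp_pos (-1))] with s hs
    have h0 := h.modulus_nonneg hs.1.le
    have hl : 1 ≤ Real.log (1 / s) := by
      have := Real.log_le_log hs.1 hs.2
      rw [Real.log_exp] at this
      rw [one_div, Real.log_inv]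
      linarith
    calc ω s = ω s * 1 := (mul_one _).symm
      _ ≤ ω s * Real.log (1 / s) := mul_le_mul_of_nonneg_left hl h0

end IsCuspRemainder

/-! ## The cusp modulus with remainder -/

/-- **Cusp modulus with remainder** (RH-free regularity HYPOTHESIS on a window state): the
open-window truncation satisfies `‖ũ(y) − ũ(x)‖ ≤ C (Γ_a(y) − Γ_a(x)) + (Ξ(y) − Ξ(x))` for
`−a ≤ x ≤ y ≤ a` — Lipschitz in the cusp coordinate up to a monotone remainder `Ξ` (which carries
the interior cusps at `±(a − log q)`). [folklore] -/
def HasCuspModulusWith (a : ℝ) (u : ℝ → ℂ) (C : ℝ) (Ξ : ℝ → ℝ) : Prop :=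
  ∀ ⦃x y : ℝ⦄, -a ≤ x → x ≤ y → y ≤ a →
    ‖weilTrunc a u y - weilTrunc a u x‖ ≤ C * (cuspCoord a y - cuspCoord a x) + (Ξ y - Ξ x)

/-- A cusp modulus is a cusp modulus with zero remainder. [folklore] -/
theorem HasCuspModulus.hasCuspModulusWith {C : ℝ} (hC : HasCuspModulus a u C) :
    HasCuspModulusWith a u C (fun _ ↦ 0) := fun x y hx hxy hy ↦ by
  simpa using hC hx hxy hy

namespace HasCuspModulusWith

variable {C : ℝ} {Ξ ω : ℝ → ℝ}

/-- **Cusp profile with remainder**: `‖ũ(y)‖ ≤ C G(a − |y|) + ω(a − |y|)` for `|y| ≤ a`.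
[folklore] -/
theorem norm_le (hC : HasCuspModulusWith a u C Ξ) (hR : IsCuspRemainder Ξ ω) {y : ℝ}
    (hy : |y| ≤ a) : ‖weilTrunc a u y‖ ≤ C * cuspPrim a (a - |y|) + ω (a - |y|) := by
  have ha : 0 ≤ a := (abs_nonneg y).trans hy
  rcases le_or_gt 0 y with h0 | h0
  · rw [abs_of_nonneg h0] at hy ⊢
    have h := hC (x := y) (y := a) (by linarith) hy le_rfl
    rw [weilTrunc_eq_zero u (le_of_eq (abs_of_nonneg ha).symm), zero_sub, norm_neg,
      cuspCoord_self ha, cuspCoord_of_nonneg a h0] at h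
    have hΞ := hR.sub_le_of_le (x := y) (y := a) (s := a - y) hy (by linarith)
    linarith
  · rw [abs_of_neg h0] at hy ⊢
    have h := hC (x := -a) (y := y) (by linarith) (by linarith) (by linarith)
    rw [weilTrunc_eq_zero u (x := -a) (by rw [abs_neg, abs_of_nonneg ha]), sub_zero,
      cuspCoord_neg_self ha, cuspCoord_of_nonpos a h0.le] at h
    have hΞ := hR.sub_le_of_le (x := -a) (y := y) (s := a - -y) (by linarith) (by linarith)
    have e : a + y = a - -y := by ring
    rw [← e] at hΞ ⊢
    linarith

/-- **Sup bound**: `‖ũ(y)‖ ≤ C G(a) + ω(2a)` everywhere (`a > 0`, `C ≥ 0`). [folklore] -/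
theorem norm_le_prim (hC : HasCuspModulusWith a u C Ξ) (hR : IsCuspRemainder Ξ ω) (hC0 : 0 ≤ C)
    (ha : 0 < a) (y : ℝ) : ‖weilTrunc a u y‖ ≤ C * cuspPrim a a + ω (2 * a) := by
  rcases le_or_gt (|y|) a with hy | hy
  · refine (hC.norm_le hR hy).trans (add_le_add ?_ ?_)
    · exact mul_le_mul_of_nonneg_left
        (cuspPrim_mono (by linarith [abs_nonneg y]) (by linarith [abs_nonneg y]) le_rfl) hC0
    · exact hR.modulus_mono (by linarith [abs_nonneg y])
  · rw [weilTrunc_eq_zero u hy.le, norm_zero]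
    exact add_nonneg (mul_nonneg hC0 (cuspPrim_nonneg a a)) (hR.modulus_nonneg (by linarith))

/-- The dilation increment with remainder: for `|x| ≤ a/(1+η)` (`0 ≤ η ≤ 1`),
`‖ũ((1+η)x) − ũ(x)‖ ≤ C (Γ(|x| + h) − Γ(|x|)) + (Ξ(x + h) − Ξ(x − h))`, `h = h(η)`. [folklore] -/
theorem norm_sub_dilate_le (hC : HasCuspModulusWith a u C Ξ) (hR : IsCuspRemainder Ξ ω)
    (hC0 : 0 ≤ C) (ha : 0 < a) {η : ℝ} (hη : 0 ≤ η) (hη1 : η ≤ 1) {x : ℝ}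
    (hx : |x| ≤ a / (1 + η)) :
    ‖weilTrunc a u ((1 + η) * x) - weilTrunc a u x‖ ≤
      C * (cuspCoord a (|x| + layerDepth a η) - cuspCoord a |x|) +
        (Ξ (x + layerDepth a η) - Ξ (x - layerDepth a η)) := by
  have hη0 : 0 < 1 + η := by linarith
  have hb : a / (1 + η) ≤ a := div_le_self ha.le (by linarith)
  have hxa : (1 + η) * |x| ≤ a := by rwa [le_div_iff₀ hη0, mul_comm] at hx
  have hh : layerDepth a η = η * (a / (1 + η)) := layerDepth_eq_mul
  have hh0 : 0 ≤ layerDepth a η := by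
    rw [hh]; exact mul_nonneg hη (div_nonneg ha.le hη0.le)
  have hηx : η * |x| ≤ layerDepth a η := by rw [hh]; exact mul_le_mul_of_nonneg_left hx hη
  have hmono : cuspCoord a ((1 + η) * |x|) ≤ cuspCoord a (|x| + layerDepth a η) := by
    have h0 : 0 ≤ (1 + η) * |x| := mul_nonneg hη0.le (abs_nonneg x)
    refine cuspCoord_mono (a := a) (by linarith) ?_ ?_
    · nlinarith [abs_nonneg x]
    · have := layerDepth_le_window ha.le hη hη1
      calc |x| + layerDepth a η ≤ a / (1 + η) + η * (a / (1 + η)) := by rw [← hh]; linarith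
        _ = a := by field_simp
  rcases le_or_gt 0 x with h0 | h0
  · have hxe : |x| = x := abs_of_nonneg h0
    rw [hxe] at hxa hmono hηx ⊢
    have h := hC (x := x) (y := (1 + η) * x) (by linarith) (by nlinarith) hxa
    have hΞ1 : Ξ ((1 + η) * x) ≤ Ξ (x + layerDepth a η) := hR.mono (by nlinarith)
    have hΞ2 : Ξ (x - layerDepth a η) ≤ Ξ x := hR.mono (by linarith)
    have hΓ : C * (cuspCoord a ((1 + η) * x) - cuspCoord a x) ≤
        C * (cuspCoord a (x + layerDepth a η) - cuspCoord a x) :=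
      mul_le_mul_of_nonneg_left (by linarith) hC0
    linarith
  · have hxn : |x| = -x := abs_of_neg h0
    rw [hxn] at hxa hmono hηx ⊢
    have h := hC (x := (1 + η) * x) (y := x) (by linarith) (by nlinarith) (by linarith)
    rw [norm_sub_rev] at h
    have hΞ1 : Ξ (x - layerDepth a η) ≤ Ξ ((1 + η) * x) := hR.mono (by nlinarith)
    have hΞ2 : Ξ x ≤ Ξ (x + layerDepth a η) := hR.mono (by linarith)
    rw [show (1 + η) * -x = -((1 + η) * x) by ring,
      show -x + layerDepth a η = -(x - layerDepth a η) by ring, cuspCoord_neg, cuspCoord_neg]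
      at hmono
    rw [show -x + layerDepth a η = -(x - layerDepth a η) by ring, cuspCoord_neg, cuspCoord_neg]
    have hΓ : C * (cuspCoord a x - cuspCoord a ((1 + η) * x)) ≤
        C * (-cuspCoord a (x - layerDepth a η) - -cuspCoord a x) :=
      mul_le_mul_of_nonneg_left (by linarith) hC0
    linarith

end HasCuspModulusWith

/-! ## The germ under a cusp modulus with remainder -/

/-- **Germ bound with remainder**:
`‖g_η(x)‖ ≤ η (C G(a) + ω(2a)) + C (Γ(|x|+h) − Γ(|x|)) + (Ξ(x+h) − Ξ(x−h))` for
`|x| ≤ a/(1+η)` (`0 ≤ η ≤ 1`, `C ≥ 0`). [folklore] -/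
theorem norm_dilationGerm_le_with {C : ℝ} {Ξ ω : ℝ → ℝ} (hC : HasCuspModulusWith a u C Ξ)
    (hR : IsCuspRemainder Ξ ω) (hC0 : 0 ≤ C) (ha : 0 < a) {η : ℝ} (hη : 0 ≤ η) (hη1 : η ≤ 1)
    {x : ℝ} (hx : |x| ≤ a / (1 + η)) :
    ‖dilationGerm a u η x‖ ≤
      η * (C * cuspPrim a a + ω (2 * a)) +
        C * (cuspCoord a (|x| + layerDepth a η) - cuspCoord a |x|) +
        (Ξ (x + layerDepth a η) - Ξ (x - layerDepth a η)) := by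
  have h1 : ‖((Real.sqrt (1 + η) : ℂ) - 1) * weilTrunc a u ((1 + η) * x)‖ ≤
      η * (C * cuspPrim a a + ω (2 * a)) := by
    rw [norm_mul, show ((Real.sqrt (1 + η) : ℂ) - 1) = ((Real.sqrt (1 + η) - 1 : ℝ) : ℂ) by
      push_cast; ring, Complex.norm_real, Real.norm_eq_abs,
      abs_of_nonneg (by linarith [Real.one_le_sqrt.2 (by linarith : (1 : ℝ) ≤ 1 + η)])]
    exact mul_le_mul (sqrt_one_add_sub_one_le hη) (hC.norm_le_prim hR hC0 ha _) (norm_nonneg _)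
      hη
  have h2 := hC.norm_sub_dilate_le hR hC0 ha hη hη1 hx
  have e : dilationGerm a u η x = ((Real.sqrt (1 + η) : ℂ) - 1) * weilTrunc a u ((1 + η) * x)
      + (weilTrunc a u ((1 + η) * x) - weilTrunc a u x) := by
    unfold dilationGerm; ring
  rw [e]
  refine (norm_add_le _ _).trans ?_
  linarith

/-- The **dilation coordinate with remainder** `Θ'_η(z) = C Θ_η(z) + (3/2) Ξ((1+η)z) + Ξ(z)`:
the germ is `1`-Lipschitz in it. [folklore] -/
def dilationCoordWith (a C η : ℝ) (Ξ : ℝ → ℝ) : ℝ → ℝ :=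
  fun z ↦ C * dilationCoord a η z + (3 / 2 * Ξ ((1 + η) * z) + Ξ z)

/-- `Θ'_η` is increasing on the compressed window (`C ≥ 0`, `η ≥ 0`). [folklore] -/
theorem dilationCoordWith_monotoneOn {C : ℝ} {Ξ ω : ℝ → ℝ} (hR : IsCuspRemainder Ξ ω)
    (hC0 : 0 ≤ C) (ha : 0 < a) {η : ℝ} (hη : 0 ≤ η) :
    MonotoneOn (dilationCoordWith a C η Ξ) (Icc (-(a / (1 + η))) (a / (1 + η))) := by
  intro x hx y hy hxy
  have h1 := dilationCoord_monotoneOn ha hη hx hy hxy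
  have h2 : Ξ ((1 + η) * x) ≤ Ξ ((1 + η) * y) := hR.mono (by nlinarith)
  have h3 : Ξ x ≤ Ξ y := hR.mono hxy
  unfold dilationCoordWith
  nlinarith [mul_le_mul_of_nonneg_left h1 hC0]

/-- **The germ is `1`-Lipschitz in `Θ'_η`** on the compressed window (`0 ≤ η ≤ 1`, `C ≥ 0`).
[folklore] -/
theorem norm_dilationGerm_sub_le_with {C : ℝ} {Ξ ω : ℝ → ℝ} (hC : HasCuspModulusWith a u C Ξ)
    (hR : IsCuspRemainder Ξ ω) (hC0 : 0 ≤ C) (ha : 0 < a) {η : ℝ} (hη : 0 ≤ η) (hη1 : η ≤ 1)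
    {x y : ℝ} (hx : -(a / (1 + η)) ≤ x) (hxy : x ≤ y) (hy : y ≤ a / (1 + η)) :
    ‖dilationGerm a u η y - dilationGerm a u η x‖ ≤
      dilationCoordWith a C η Ξ y - dilationCoordWith a C η Ξ x := by
  have hη0 : 0 < 1 + η := by linarith
  have hb : a / (1 + η) ≤ a := div_le_self ha.le (by linarith)
  have hxa := (window_of_mem_compressed hη0 hx (hxy.trans hy)).1
  have hya := (window_of_mem_compressed hη0 (hx.trans hxy) hy).2
  have hxy' : (1 + η) * x ≤ (1 + η) * y := by nlinarith
  have h1 := hC hxa hxy' hya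
  have h2 := hC (x := x) (y := y) (by linarith) hxy (by linarith)
  have h3 : 0 ≤ cuspCoord a ((1 + η) * y) - cuspCoord a ((1 + η) * x) :=
    _root_.sub_nonneg.2 (cuspCoord_mono hxa hxy' hya)
  have h4 : 0 ≤ Ξ ((1 + η) * y) - Ξ ((1 + η) * x) := hR.sub_nonneg hxy'
  have hs := sqrt_one_add_le hη1
  have hs0 : 0 ≤ Real.sqrt (1 + η) := Real.sqrt_nonneg _
  have e : dilationGerm a u η y - dilationGerm a u η x =
      (Real.sqrt (1 + η) : ℂ) * (weilTrunc a u ((1 + η) * y) - weilTrunc a u ((1 + η) * x)) -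
        (weilTrunc a u y - weilTrunc a u x) := by
    unfold dilationGerm; ring
  rw [e]
  refine (norm_sub_le _ _).trans ?_
  rw [norm_mul, Complex.norm_real, Real.norm_eq_abs, abs_of_nonneg hs0]
  unfold dilationCoordWith dilationCoord
  have h5 : 0 ≤ C * (cuspCoord a ((1 + η) * y) - cuspCoord a ((1 + η) * x)) +
      (Ξ ((1 + η) * y) - Ξ ((1 + η) * x)) := add_nonneg (mul_nonneg hC0 h3) h4
  nlinarith [mul_le_mul hs h1 (norm_nonneg _) (by norm_num : (0 : ℝ) ≤ 3 / 2)]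

/-- **Modulus of `Θ'_η` at the layer scale**: for `x ≤ y ≤ x + s` in the compressed window with
`s ≤ h(η)` (`0 ≤ η ≤ 1`, `C ≥ 0`), `Θ'_η(y) − Θ'_η(x) ≤ 5 C G(2h) + (5/2) ω(2h)`. [folklore] -/
theorem dilationCoordWith_sub_le {C : ℝ} {Ξ ω : ℝ → ℝ} (hR : IsCuspRemainder Ξ ω) (hC0 : 0 ≤ C)
    (ha : 0 < a) {η : ℝ} (hη : 0 ≤ η) (hη1 : η ≤ 1) {x y s : ℝ} (hx : -(a / (1 + η)) ≤ x)
    (hxy : x ≤ y) (hy : y ≤ a / (1 + η)) (hys : y ≤ x + s) (hs : s ≤ layerDepth a η) :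
    dilationCoordWith a C η Ξ y - dilationCoordWith a C η Ξ x ≤
      5 * C * cuspPrim a (2 * layerDepth a η) + 5 / 2 * ω (2 * layerDepth a η) := by
  have h1 := dilationCoord_sub_le ha hη hη1 hx hxy hy hys hs
  have h2 : Ξ ((1 + η) * y) - Ξ ((1 + η) * x) ≤ ω (2 * layerDepth a η) :=
    hR.sub_le_of_le (by nlinarith) (by nlinarith)
  have h3 : Ξ y - Ξ x ≤ ω (2 * layerDepth a η) :=
    hR.sub_le_of_le hxy (by linarith [hs, hys, show 0 ≤ s by linarith])
  unfold dilationCoordWith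
  nlinarith [mul_le_mul_of_nonneg_left h1 hC0]

/-- **Width of `Θ'_η`**: `Θ'_η(b) − Θ'_η(−b) ≤ 5 C G(a) + (5/2) ω(2a)` on the compressed window
`b = a/(1+η)` (`C ≥ 0`, `η ≥ 0`). [folklore] -/
theorem dilationCoordWith_width {C : ℝ} {Ξ ω : ℝ → ℝ} (hR : IsCuspRemainder Ξ ω) (hC0 : 0 ≤ C)
    (ha : 0 < a) {η : ℝ} (hη : 0 ≤ η) :
    dilationCoordWith a C η Ξ (a / (1 + η)) - dilationCoordWith a C η Ξ (-(a / (1 + η))) ≤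
      5 * C * cuspPrim a a + 5 / 2 * ω (2 * a) := by
  have hη0 : 0 < 1 + η := by linarith
  have hb : a / (1 + η) ≤ a := div_le_self ha.le (by linarith)
  have hb0 : 0 ≤ a / (1 + η) := div_nonneg ha.le hη0.le
  have h1 := dilationCoord_width ha hη
  have e1 : (1 + η) * (a / (1 + η)) = a := by field_simp
  have e2 : (1 + η) * -(a / (1 + η)) = -a := by field_simp
  have h2 : Ξ a - Ξ (-a) ≤ ω (2 * a) := hR.sub_le_of_le (by linarith) (by linarith)
  have h3 : Ξ (a / (1 + η)) - Ξ (-(a / (1 + η))) ≤ ω (2 * a) :=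
    hR.sub_le_of_le (by linarith) (by linarith)
  unfold dilationCoordWith
  rw [e1, e2]
  nlinarith [mul_le_mul_of_nonneg_left h1 hC0]

/-! ## Increments of the interior defect -/

/-- The **near rate** `Φ(η) = M·W + 2 (M + J)²` with `M = 5 C G(2h) + (5/2) ω(2h)` (modulus of
`Θ'_η` at scale `h`), `W = 5 C G(a) + (5/2) ω(2a)` (its width) and `J = C G(2h) + ω(2h)` (the
endpoint values): `D_s(t_η) ≤ s Φ(η)` for `s ≤ h = h(η)`. [folklore] -/
def cuspNearRate (a C : ℝ) (ω : ℝ → ℝ) (η : ℝ) : ℝ :=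
  (5 * C * cuspPrim a (2 * layerDepth a η) + 5 / 2 * ω (2 * layerDepth a η)) *
      (5 * C * cuspPrim a a + 5 / 2 * ω (2 * a)) +
    2 * ((5 * C * cuspPrim a (2 * layerDepth a η) + 5 / 2 * ω (2 * layerDepth a η)) +
      (C * cuspPrim a (2 * layerDepth a η) + ω (2 * layerDepth a η))) ^ 2

/-- `Φ(η) → 0` as `η → 0⁺` (`G(2h) → 0`, `ω(2h) → 0`). [folklore] -/
theorem tendsto_cuspNearRate {C : ℝ} {Ξ ω : ℝ → ℝ} (hR : IsCuspRemainder Ξ ω) (ha : 0 < a) :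
    Tendsto (cuspNearRate a C ω) (𝓝[>] 0) (𝓝 0) := by
  have hr := tendsto_cuspPrim_two_mul_layerDepth ha
  have hω : Tendsto (fun η ↦ ω (2 * layerDepth a η)) (𝓝[>] 0) (𝓝 0) := by
    refine hR.tendsto_modulus.comp ?_
    have hh := tendsto_nhdsWithin_iff.1 (tendsto_layerDepth ha)
    refine tendsto_nhdsWithin_iff.2 ⟨?_, ?_⟩
    · simpa using hh.1.const_mul 2
    · filter_upwards [hh.2] with η hη
      rw [mem_Ioi] at hη ⊢
      linarith
  have hM := (hr.const_mul (5 * C)).add (hω.const_mul (5 / 2))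
  have hJ := (hr.const_mul C).add hω
  have T := (hM.mul_const (5 * C * cuspPrim a a + 5 / 2 * ω (2 * a))).add
    (((hM.add hJ).pow 2).const_mul 2)
  simp only [mul_zero, add_zero, ne_eq, OfNat.ofNat_ne_zero, not_false_eq_true, zero_pow,
    zero_mul] at T
  exact T

/-- **Increments of the interior defect under a cusp modulus with remainder**: for
`0 < s ≤ h(η)` (`0 < η ≤ 1`, `C ≥ 0`), `D_s(t_η) ≤ s · cuspNearRate a C ω η`.
[cite: Bombieri2000Weil, §4 proof of Thm 5 (the dilation)] -/
theorem weilIncrement_weilInteriorDefect_le_with {C : ℝ} {Ξ ω : ℝ → ℝ}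
    (hC : HasCuspModulusWith a u C Ξ) (hR : IsCuspRemainder Ξ ω) (hC0 : 0 ≤ C) (ha : 0 < a)
    {η : ℝ} (hη : 0 < η) (hη1 : η ≤ 1) {s : ℝ} (hs : 0 < s) (hsh : s ≤ layerDepth a η) :
    weilIncrement (weilInteriorDefect a u η) s ≤ s * cuspNearRate a C ω η := by
  have hη0 : 0 < 1 + η := by linarith
  set b := a / (1 + η) with hb_def
  set r := cuspPrim a (2 * layerDepth a η) with hr_def
  set w := ω (2 * layerDepth a η) with hw_def
  have hb : b ≤ a := div_le_self ha.le (by linarith)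
  have hhb : layerDepth a η ≤ b := layerDepth_le_window ha.le hη.le hη1
  have hh0 : 0 < layerDepth a η := layerDepth_pos ha hη
  have hh2 : 2 * layerDepth a η ≤ a := by linarith [layerDepth_le_half ha.le hη.le hη1]
  have hr1 : cuspPrim a (layerDepth a η) ≤ r := cuspPrim_mono hh0.le (by linarith) hh2
  have hw1 : ω (layerDepth a η) ≤ w := hR.modulus_mono (by linarith)
  have hab : a - b = layerDepth a η := by
    rw [hb_def, ← sub_layerDepth (a := a) (by linarith : (-1 : ℝ) < η)]; ring
  rw [weilInteriorDefect_eq_indicator hη]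
  -- endpoint values
  have hJ : ∀ z, |z| = b → ‖(Icc (-b) b).indicator (dilationGerm a u η) z‖ ≤ C * r + w := by
    intro z hz
    have hzm : z ∈ Icc (-b) b := abs_le.1 hz.le
    rw [indicator_of_mem hzm, dilationGerm, weilTrunc_eq_zero u (x := (1 + η) * z)
      (by rw [abs_mul, abs_of_pos hη0, hz, hb_def]; field_simp; rfl), mul_zero, zero_sub,
      norm_neg]
    have := hC.norm_le hR (y := z) (by rw [hz]; exact hb)
    rw [hz, hab] at this
    nlinarith
  have hmain := weilIncrement_le_of_lipschitzCoord
    (t := (Icc (-b) b).indicator (dilationGerm a u η)) (Θ := dilationCoordWith a C η Ξ) (C := 1)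
    (J := C * r + w) (ω := 5 * C * r + 5 / 2 * w) hs (by linarith) zero_le_one
    (fun x hx ↦ indicator_of_notMem hx _) (dilationCoordWith_monotoneOn hR hC0 ha hη.le)
    (fun x hx y hy hxy ↦ by
      rw [indicator_of_mem hx, indicator_of_mem hy, one_mul]
      exact norm_dilationGerm_sub_le_with hC hR hC0 ha hη.le hη1 hx.1 hxy hy.2)
    (fun x hx y hy hxy hys ↦ dilationCoordWith_sub_le hR hC0 ha hη.le hη1 hx.1 hxy hy.2 hys hsh)
    (hJ b (abs_of_nonneg (by linarith))) (hJ (-b) (by rw [abs_neg, abs_of_nonneg (by linarith)]))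
  have hW := dilationCoordWith_width hR hC0 ha hη.le
  have hr0 : 0 ≤ r := cuspPrim_nonneg _ _
  have hw0 : 0 ≤ w := hR.modulus_nonneg (by linarith)
  have hM0 : 0 ≤ 5 * C * r + 5 / 2 * w := by positivity
  calc weilIncrement ((Icc (-b) b).indicator (dilationGerm a u η)) s
      ≤ s * ((5 * C * r + 5 / 2 * w) *
          (dilationCoordWith a C η Ξ b - dilationCoordWith a C η Ξ (-b)) +
          2 * ((5 * C * r + 5 / 2 * w) + (C * r + w)) ^ 2) := by
        simpa only [one_pow, one_mul] using hmain
    _ ≤ s * cuspNearRate a C ω η := by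
        refine mul_le_mul_of_nonneg_left ?_ hs.le
        unfold cuspNearRate
        rw [← hr_def, ← hw_def]
        nlinarith [mul_le_mul_of_nonneg_left hW hM0]

end Summit.RiemannHypothesis.RiemannHypothesis.Theorems.PfPersistence

end
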